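import Summits.CriticalPhenomena.PercolationContinuityZ3.Theorems.Transplant.Slab111K3Continuity
import Summits.CriticalPhenomena.PercolationContinuityZ3.Theorems.Transplant.Slab111SKFinalK4
import Summits.CriticalPhenomena.PercolationContinuityZ3.Theorems.Transplant.Slab111SKFinalK5
import Summits.CriticalPhenomena.PercolationContinuityZ3.Theorems.Transplant.Slab111SKFinalK6
import Summits.CriticalPhenomena.PercolationContinuityZ3.Theorems.Transplant.Slab111SKFinalK7
import Summits.CriticalPhenomena.PercolationContinuityZ3.Theorems.Transplant.Slab111SKFinalK8
import Summits.CriticalPhenomena.PercolationContinuityZ3.Theorems.Transplant.Slab111SKFinalK9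
import Summits.CriticalPhenomena.PercolationContinuityZ3.Theorems.Transplant.Slab111HubXFinal
import Summits.CriticalPhenomena.PercolationContinuityZ3.Theorems.Transplant.Slab111Honeycomb
import HarnessLib

/-!
# The `(111)`-row of class C1b WITHOUT p205010: `Slab111OwnCriticalContinuity k` for every `k ≥ 1`, `k ≠ 2`; the `(111)`-conjunct of TARGET 2x reduces to the dice lattice

builds on p205010 (kernel theorem, internal audit signed; external expert review pending) — NOT used: p205010's declarations are absent from the DECLARATION-LEVEL cones
of the theorems below (transitive used-constants closures contain no `…Theorems.CSH.*` / `PercNearOneGluing*` constant; the import graph is NOT separated — shared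
scope/statement modules import p205010's module).  Lane `prim-bschramm`,
seat `prim-bschramm-p2` (gen 39; class C1b; memo `HOME/bschramm/P2-LATTICES.md` §137); helper file (`--supports stmt-CriticalPhenomena-4575 --as helper`).
Assembly of the p205010-free certifications of the `(111)`-films `F_k = {0 ≤ x₀+x₁+x₂ ≤ k}` of `ℤ³` at their own critical points: `k = 1` honeycomb («Slab111Honeycomb»,
Wierman / Bollobás–Riordan), `k = 3` («Slab111K3Continuity»: radius-4 kernel certificates + the radius-generic routing «HexShadowVRoutingR»), `4 ≤ k ≤ 9`
(«Slab111SKFinalK4…K9»: radius-3 bitboard certificates), `k ≥ 10` («Slab111HubXFinal»: the zone-free hub dispatcher) — **`slab111OwnCriticalContinuity_ne_two`** —, and the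
reduction of the `(111)`-conjunct of `ObliqueFilmOwnCriticalContinuity` («StatementObliqueFilms») to the ONE remaining film, the planar dice lattice `F_2`:
**`obliqueFilm_slab111_conjunct_iff_two`**.  (The master file «Slab111SmallKFinal» is deliberately not imported: this file re-dispatches `k ≥ 4` from the per-`k` finals.)
[cite: DuminilCopinSidoraviciusTassion2016, Thm. 1, §2.3] [cite: BollobasRiordan2006, Ch. 5, Thm. 16–17] [cite: BenjaminiSchramm1996, Conj. 4 / Question 3]
-/

noncomputable section

namespace Summit.CriticalPhenomena.PercolationContinuityZ3.Theorems.Transplant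

open Literature.Probability.Percolation Literature.Probability.LatticeModels SimpleGraph

/-- **EVERY `(111)`-FILM OF THICKNESS `k ≥ 3` DIES AT ITS OWN CRITICAL POINT — independently of p205010** (`k = 3`: radius `4`; `4 ≤ k ≤ 9`: radius-`3` bitboard
certificates; `k ≥ 10`: the zone-free hub dispatcher). [cite: DuminilCopinSidoraviciusTassion2016, Thm. 1, §2.3] [cite: BenjaminiSchramm1996, Conj. 4 / Question 3] -/
theorem slab111OwnCriticalContinuity_three_le {k : ℕ} (hk : 3 ≤ k) : Slab111OwnCriticalContinuity k := by
  rcases Nat.lt_or_ge k 10 with h10 | h10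
  · interval_cases k
    · exact slab111OwnCriticalContinuity_k3
    · exact slab111OwnCriticalContinuity_of_shapedLinkage (by norm_num) Slab111.shapedLinkage_three_k4
    · exact slab111OwnCriticalContinuity_of_shapedLinkage (by norm_num) Slab111.shapedLinkage_three_k5
    · exact slab111OwnCriticalContinuity_of_shapedLinkage (by norm_num) Slab111.shapedLinkage_three_k6
    · exact slab111OwnCriticalContinuity_of_shapedLinkage (by norm_num) Slab111.shapedLinkage_three_k7
    · exact slab111OwnCriticalContinuity_of_shapedLinkage (by norm_num) Slab111.shapedLinkage_three_k8
    · exact slab111OwnCriticalContinuity_of_shapedLinkage (by norm_num) Slab111.shapedLinkage_three_k9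
  · exact slab111OwnCriticalContinuity_of_hubX h10

/-- **THE `(111)`-ROW OF CLASS C1b WITHOUT p205010: `Slab111OwnCriticalContinuity k` for every `k ≥ 1`, `k ≠ 2`** (`k = 1` is the honeycomb lattice — in the tree;
`k ≥ 3` by the hexagonal-shadow transplant of DST 2016 with kernel-certified local linkage).  The dice lattice `F_2` is planar and is closed only by name (via p205010,
«Slab111OwnCriticalContinuityHolds»). [cite: DuminilCopinSidoraviciusTassion2016, Thm. 1, §2.3] [cite: BollobasRiordan2006, Ch. 5, Thm. 16–17] [cite: BenjaminiSchramm1996, Conj. 4 / Question 3] -/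
theorem slab111OwnCriticalContinuity_ne_two {k : ℕ} (hk : 1 ≤ k) (h2 : k ≠ 2) : Slab111OwnCriticalContinuity k := by
  rcases Nat.lt_or_ge k 3 with h3 | h3
  · obtain rfl : k = 1 := by omega
    exact slab111OwnCriticalContinuity_one
  · exact slab111OwnCriticalContinuity_three_le h3

/-- **The `(111)`-conjunct of TARGET 2x `ObliqueFilmOwnCriticalContinuity` is equivalent, WITHOUT p205010, to the single planar case `k = 2` (the dice lattice).**
[cite: BenjaminiSchramm1996, Conj. 4 / Question 3] -/
theorem obliqueFilm_slab111_conjunct_iff_two : (∀ k : ℕ, 1 ≤ k → Slab111OwnCriticalContinuity k) ↔ Slab111OwnCriticalContinuity 2 := by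
  refine ⟨fun h => h 2 (by norm_num), fun h2 k hk => ?_⟩
  by_cases hk2 : k = 2
  · subst hk2; exact h2
  · exact slab111OwnCriticalContinuity_ne_two hk hk2

end Summit.CriticalPhenomena.PercolationContinuityZ3.Theorems.Transplant

end
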